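import Summits.FinalStateConjecture.FinalStateConjecture.Theorems.BartnikGapSettlingCaptureSoundDefs
import Summits.FinalStateConjecture.FinalStateConjecture.Theorems.BartnikGapSettlingCaptureNormalFormAbstract
import Literature.Geometry.Lorentzian.SoundNearKerrLeaf
import HarnessLib

/-!
# Sound normal form of the re-typed crux: `SoundCapture ↔ ∀ N, sound sector N`
# (crux stmt-FinalStateConjecture-10115; routes `BartnikGapSettling` / `QuietWindowCapture`)

Crux-level glue for the re-typing of `Capture` over sound leaves
(`CauchyDevelopment.IsSoundNearKerrLeaf`, p125168 — second revision).  `SoundCapture`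
(`Theorems/BartnikGapSettlingCaptureSoundDefs.lean`, p125313) is the crux text with the inlined leaf
block replaced by the sound leaf predicate.  This file proves the planners' NORMAL FORM: the sound
crux is EQUIVALENT to the conjunction over hole counts `N` of "sound pinned capture at `N`" — fixed
positive sub-extremal labels `(M⋆, a⋆)` and sound leaves `η`-pinned to them for every `η > 0`,
beyond every `J⁻(K)`, at every `(k, ε)`, imply settling.

Proof (line `Sketch` §9, `honestCapture_iff_forall`; identical to the first-revision file
`BartnikGapSettlingCaptureHonestSector.lean`, p124960, with the sound predicate), adapted to the inlined statements):
(→) at `N = 0` the tuple `(N₀, m₀, χ, k₁, ε₁) = (0, 1, 0, 0, 1)` with the `1`-pinned leaves (window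
and margin vacuous over `Fin 0`); at `N ≥ 1` the explicit window/margin of
`NormalForm.exists_window_of_subextremal` with the `η`-pinned leaves.  (←) hole-count stabilisation
`NormalForm.holeCount_abstract` and label pinning `NormalForm.pinning_abstract` (p116342) applied to
the sound leaf predicate, which is monotone in `(k, ε)` (`IsSoundNearKerrLeaf.mono`); the pinned
labels are positive sub-extremal since `0 < m₀ ≤ M⋆ᵢ` and `|a⋆ᵢ| ≤ χ M⋆ᵢ < M⋆ᵢ` (`χ < 1`).

References: Dafermos–Holzegel–Rodnianski–Taylor arXiv:2104.08222, §1 (leaf vocabulary); O'Neill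
1983, Ch. 14, p. 403 (monotonicity of causal pasts).  No named facts; no definitions.
[DafermosHolzegelRodnianskiTaylor2021] [ONeillSemiRiemannian1983]
-/

noncomputable section

-- the doubled `FinalStateConjecture` path component is the summit/problem naming scheme
set_option linter.dupNamespace false

namespace Summit.FinalStateConjecture.FinalStateConjecture.Theorems.BartnikGapSettling.Capture

open Set Filter Function Topology
open scoped Manifold ContDiff ENNReal Topology
open Literature.Geometry.Lorentzian

/-- **Normal form of the sound crux**: `SoundCapture ↔ ∀ N, sound pinned capture at hole count N`
(hole-count stabilisation and label pinning hold for sound leaves by the abstract lemmas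
`NormalForm.holeCount_abstract` / `NormalForm.pinning_abstract`, sound leaves being monotone in
`(k, ε)`; conversely sound pinned leaves at positive sub-extremal labels are sound
near-sub-extremal-Kerr leaves for the explicit tuple of `NormalForm.exists_window_of_subextremal`, and
for the trivial tuple `(0, 1, 0, 0, 1)` at `N = 0`).  After re-typing, the sectors `N = 0`
(dispersal), `N = 1` (leaf-form sub-extremal Kerr stability) and `N ≥ 2` (multi-Kerr capture) are
the statement items (DHRT arXiv:2104.08222, §1 for the vocabulary). [folklore] -/
theorem soundCapture_iff_forall_sector :
    SoundCapture ↔ ∀ (N : ℕ) (X : Type) [TopologicalSpace X] [ChartedSpace E3 X]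
      [IsManifold (𝓡 3) ∞ X] [T2Space X] [SecondCountableTopology X] [ConnectedSpace X],
      ∀ D ∈ admissibleVacuumData X, ∀ 𝒟 : VacuumCauchyDevelopment D, 𝒟.IsMaximal →
        Summit.FinalStateConjecture.HasCompleteNullInfinity 𝒟.toCauchyDevelopment →
          ∀ (M₀ a₀ : Fin N → ℝ), (∀ i, 0 < M₀ i ∧ |a₀ i| < M₀ i) →
            (∀ η : ℝ, 0 < η → ∀ (k : ℕ) (ε : ℝ≥0∞), 0 < ε → ∀ K : Set 𝒟.carrier, IsCompact K →
              ∃ (M a : Fin N → ℝ) (S : Set 𝒟.carrier),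
                (∀ i, |M i - M₀ i| ≤ η ∧ |a i - a₀ i| ≤ η) ∧
                  Disjoint S (𝒟.metric.causalPast 𝒟.timeOrientation K) ∧
                    𝒟.toCauchyDevelopment.IsSoundNearKerrLeaf k ε N M a S) →
            ∃ (O : Set 𝒟.carrier) (d : FinalStateDecomposition 𝒟.toSpacetime O 2),
              (∀ i, Kerr.IsSubextremal (d.mass i) (d.spin i)) ∧
                O = Summit.FinalStateConjecture.exteriorOf 𝒟.toCauchyDevelopment d.charted ∧
                  Summit.FinalStateConjecture.HasExhaustiveCharts d := by
  constructor
  · intro h N X _ _ _ _ _ _ D hD 𝒟 hmax hCNI M₀ a₀ hsub hpin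
    refine h X D hD 𝒟 hmax hCNI ?_
    rcases Nat.eq_zero_or_pos N with rfl | hN
    · refine ⟨0, 1, 0, 0, 1, one_pos, one_pos, one_pos, fun k ε hε K hK ↦ ?_⟩
      obtain ⟨M, a, S, -, hdisj, hleaf⟩ := hpin 1 one_pos k ε hε K hK
      exact ⟨0, M, a, S, le_rfl, fun i ↦ i.elim0, hdisj, hleaf, fun _ _ i ↦ i.elim0⟩
    · obtain ⟨η, m₀, χ, hη, hm₀, hχ, hwin⟩ :=
        NormalForm.exists_window_of_subextremal N hN M₀ a₀ hsub
      refine ⟨N, m₀, χ, 0, 1, hm₀, hχ, one_pos, fun k ε hε K hK ↦ ?_⟩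
      obtain ⟨M, a, S, hcl, hdisj, hleaf⟩ := hpin η hη k ε hε K hK
      exact ⟨N, M, a, S, le_rfl, fun i ↦ ⟨(hwin M a hcl i).1, (hwin M a hcl i).2.1⟩, hdisj, hleaf,
        fun _ _ i ↦ (hwin M a hcl i).2.2⟩
  · intro h X _ _ _ _ _ _ D hD 𝒟 hmax hCNI hyp
    obtain ⟨N₀, m₀, χ, k₁, ε₁, hm₀, hχ, hε₁, H⟩ := hyp
    obtain ⟨N, -, HN⟩ := NormalForm.holeCount_abstract X D 𝒟
      (fun N k ε M a S ↦ 𝒟.toCauchyDevelopment.IsSoundNearKerrLeaf k ε N M a S)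
      (fun N k k' ε ε' M a S hk hε hl ↦ hl.mono hk hε) N₀ m₀ χ k₁ ε₁ hε₁ H
    obtain ⟨M₀, a₀, hwin, hpin⟩ := NormalForm.pinning_abstract X D 𝒟 N
      (fun k ε M a S ↦ 𝒟.toCauchyDevelopment.IsSoundNearKerrLeaf k ε N M a S)
      (fun k k' ε ε' M a S hk hε hl ↦ hl.mono hk hε) m₀ χ HN
    refine h N X D hD 𝒟 hmax hCNI M₀ a₀ (fun i ↦ ?_) hpin
    obtain ⟨hlo, -, hspin⟩ := hwin i
    have hM : 0 < M₀ i := hm₀.trans_le hlo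
    exact ⟨hM, hspin.trans_lt (by nlinarith)⟩

end Summit.FinalStateConjecture.FinalStateConjecture.Theorems.BartnikGapSettling.Capture

end
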